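import Summits.Ventures.HodgeRepro2.T5RecordJointToyInertPlaces
import Summits.Ventures.HodgeRepro2.T5CyclotomicSevenInfinitelyMany
import Summits.Ventures.HodgeRepro2.T5CyclotomicSevenHeckeCommutative

/-!
# Joint consistency at infinitely many places of the field of record

Tier-5 support N3 / §G-N4.2 (seat p3, gen 87). File 358 reads the joint statement (file 356: the lattice-model data of
file 331 for `diag(1, 1, −1)` AND the unramified spectrum of file 344, hypothesis-free) at every constructed inert
place `vPrime K p h6` of `ℚ(ζ₇)⁺`. File 261 shows by Dirichlet (Mathlib's `Nat.setOf_prime_and_eq_mod_infinite`)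
that the primes of order `6` modulo `7` are infinite and that `p ↦ vPrime K p h6` is injective. Hence:

* **`infinite_setOf_joint`** — the set of places `v` of `ℚ(ζ₇)⁺` above a prime `p` of order `6` modulo `7` that
  stay prime in `ℚ(ζ₇)` (`v 𝓞_K = w`) and at which the joint statement holds over the rational place `vRat p`
  (file 357) is INFINITE.

The predicate binds its `LiesOver` instances by explicit terms (`liesOver_vRat_of_mem`, `liesOver_of_map_eq`); the
membership proof applies file 356 with those very terms (annex §98(d)). §8(d): uses an L-value-free non-vanishing
device: NO.
-/

open Matrix NumberField NumberField.IsCMField IsDedekindDomain IsDedekindDomain.HeightOneSpectrum Module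
  MulAction
open scoped TensorProduct Pointwise
open Summit.Ventures.HodgeRepro2.T5UnitaryGroupForm Summit.Ventures.HodgeRepro2.T5UnitaryHeckeAdjoint
  Summit.Ventures.HodgeRepro2.T5HeckePermutationModule Summit.Ventures.HodgeRepro2.LevelPositivity
  Summit.Ventures.HodgeRepro2.T5LevelIdempotent Summit.Ventures.HodgeRepro2.T5StarOfInvolution
  Summit.Ventures.HodgeRepro2.T5FinitePlaceCM Summit.Ventures.HodgeRepro2.T5NonSplitPlaceUnitaryGroup
  Summit.Ventures.HodgeRepro2.T5RecordHyperspecial Summit.Ventures.HodgeRepro2.T5GlobalLatticeAlmostAll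
  Summit.Ventures.HodgeRepro2.T5HermitianThreeElements Summit.Ventures.HodgeRepro2.T5GaloisCartanThree
  Summit.Ventures.HodgeRepro2.T5InertDegreeGalois Summit.Ventures.HodgeRepro2.T5InertPlaceCompletion
  Summit.Ventures.HodgeRepro2.T5InertDegreeAdicCompletion Summit.Ventures.HodgeRepro2.T5InertSatakeTransform
  Summit.Ventures.HodgeRepro2.T5InertSatakeTransformCompletion Summit.Ventures.HodgeRepro2.T5InertUnipotentResidue
  Summit.Ventures.HodgeRepro2.T5InertSphericalSubquotient Summit.Ventures.HodgeRepro2.T5RecordSatakeCell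
  Summit.Ventures.HodgeRepro2.T5SplitPlaceUnitaryGroup Summit.Ventures.HodgeRepro2.T5FinitePlaceNormIndex
  Summit.Ventures.HodgeRepro2.T5HermitianLocalIsotropyN3 Summit.Ventures.HodgeRepro2.T5FinitePlaceSplitClassification
  Summit.Ventures.HodgeRepro2.T5InertDegreeCompletion Summit.Ventures.HodgeRepro2.T5InertPlaceCompletionCells
  Summit.Ventures.HodgeRepro2.T5RecordSatake Summit.Ventures.HodgeRepro2.T5CartanCellsDistinct
  Summit.Ventures.HodgeRepro2.T5RecordSatakeInert Summit.Ventures.HodgeRepro2.T5InertGlobalPrime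
  Summit.Ventures.HodgeRepro2.T5CMFieldSquareDatum Summit.Ventures.HodgeRepro2.T5RecordSatakeDegree
  Summit.Ventures.HodgeRepro2.T5RecordSatakeDegreeIntrinsic Summit.Ventures.HodgeRepro2.T5RecordSphericalSpectrum
  Summit.Ventures.HodgeRepro2.T5RecordSphericalSpectrumIntrinsic Summit.Ventures.HodgeRepro2.T5RecordSatakeToy
  Summit.Ventures.HodgeRepro2.T5RecordSphericalSpectrumDatumFree
  Summit.Ventures.HodgeRepro2.T5AdditiveConductor Summit.Ventures.HodgeRepro2.T5UnitaryGroupIsometry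
  Summit.Ventures.HodgeRepro2.T5ConductorDualLattice Summit.Ventures.HodgeRepro2.T5ConductorDualLatticeSplit
  Summit.Ventures.HodgeRepro2.T5SplitHermitianClass Summit.Ventures.HodgeRepro2.T5RecordLatticeModelOutsideDiscriminant
  Summit.Ventures.HodgeRepro2.T5RecordLatticeModelSeven Summit.Ventures.HodgeRepro2.T5RecordJointOutsideDiscriminant
  Summit.Ventures.HodgeRepro2.T5RationalPlace Summit.Ventures.HodgeRepro2.T5ConductorZeroCharacter
  Summit.Ventures.HodgeRepro2.T5CyclotomicSevenInertThree Summit.Ventures.HodgeRepro2.T5CyclotomicSevenInfinitelyMany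
  Summit.Ventures.HodgeRepro2.T5CyclotomicSevenHeckeCommutative Summit.Ventures.HodgeRepro2.T5RecordJointToyInertPlaces

namespace Summit.Ventures.HodgeRepro2.T5RecordJointInfinitelyMany

universe uV

section Seven

open Summit.Ventures.HodgeRepro2.T5CyclotomicSevenInertPrime

variable (K : Type*) [Field K] [CharZero K] [IsCyclotomicExtension {7} ℚ K]
variable (k : Type*) [Field k] [CharZero k] [IsAlgClosed k]

/-- **AT INFINITELY MANY PLACES OF `ℚ(ζ₇)⁺` THE JOINT STATEMENT HOLDS**: the set of places `v` above a prime `p` of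
order `6` modulo `7`, staying prime (`v 𝓞_K = w`), at which the lattice-model data for `diag(1, 1, −1)` over `vRat p`
AND the unramified spectrum of the record's pair (Satake parameter `α · N(v)⁻²`) hold, is infinite. -/
theorem infinite_setOf_joint :
    letI := numberField' K; letI := isCMField' K
    {v : HeightOneSpectrum (𝓞 (maximalRealSubfield K)) |
      ∃ (p : ℕ) (hp : Fact p.Prime) (_h6 : orderOf (p : ZMod 7) = 6) (hmem : (p : 𝓞 (maximalRealSubfield K)) ∈ v.asIdeal)
        (w : HeightOneSpectrum (𝓞 K))
        (hmap : Ideal.map (algebraMap (𝓞 (maximalRealSubfield K)) (𝓞 K)) v.asIdeal = w.asIdeal),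
        letI : v.asIdeal.LiesOver (@vRat p hp).asIdeal := @liesOver_vRat_of_mem p hp _ _ _ v hmem
        letI := liesOver_of_map_eq K v w hmap
        ((∃ ψ : AddChar ((@vRat p hp).adicCompletion ℚ) Circle, Continuous ψ ∧ (∃ y, ψ y ≠ 1) ∧
          conductorExp ψ (Valued.v : Valuation ((@vRat p hp).adicCompletion ℚ) (WithZero (Multiplicative ℤ))) = 0 ∧
          conductorExp (ψ.compAddMonoidHom
            (Algebra.trace ((@vRat p hp).adicCompletion ℚ) (v.adicCompletion (maximalRealSubfield K))).toAddMonoidHom)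
            (Valued.v : Valuation (v.adicCompletion (maximalRealSubfield K)) (WithZero (Multiplicative ℤ))) = 0) ∧
        ∀ (ψ : AddChar ((@vRat p hp).adicCompletion ℚ) Circle), Continuous ψ → (∃ y, ψ y ≠ 1) →
          conductorExp ψ (Valued.v : Valuation ((@vRat p hp).adicCompletion ℚ) (WithZero (Multiplicative ℤ))) = 0 →
          ∀ (w' : HeightOneSpectrum (𝓞 K)) [w'.asIdeal.LiesOver v.asIdeal],
            v.asIdeal.ramificationIdx' w'.asIdeal = 1 ∧
            conductorExp (recordChar K (@vRat p hp) v w' ψ)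
              (Valued.v : Valuation (w'.adicCompletion K) (WithZero (Multiplicative ℤ))) = 0 ∧
            (∀ x : w'.adicCompletion K,
              (∀ y : w'.adicCompletion K, Valued.v y ≤ 1 → recordChar K (@vRat p hp) v w' ψ (x * y) = 1) ↔ Valued.v x ≤ 1) ∧
            (∀ [StarRing (w'.adicCompletion K)],
              (∀ z : w'.adicCompletion K, IsLocalization.IsInteger (w'.adicCompletionIntegers K) z →
                IsLocalization.IsInteger (w'.adicCompletionIntegers K) (star z)) →
              ∀ x : Fin 3 → w'.adicCompletion K,
                (∀ y ∈ stdLattice (w'.adicCompletionIntegers K),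
                  recordChar K (@vRat p hp) v w' ψ
                    (sesqForm (((algebraMap (𝓞 K) K).mapMatrix (Matrix.diagonal ![1, 1, -1])).map (algebraMap K (w'.adicCompletion K))) x y) = 1) ↔
                  x ∈ stdLattice (w'.adicCompletionIntegers K)) ∧
            (letI := swapStarRing (w'.adicCompletion K)
              ∀ x : Fin 3 → w'.adicCompletion K × w'.adicCompletion K,
                (∀ y : Fin 3 → w'.adicCompletion K × w'.adicCompletion K,
                  (∀ i, Valued.v (y i).1 ≤ 1 ∧ Valued.v (y i).2 ≤ 1) →
                  recordChar K (@vRat p hp) v w' ψ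
                      (sesqForm (pairMatrix (((algebraMap (𝓞 K) K).mapMatrix (Matrix.diagonal ![1, 1, -1])).map (algebraMap K (w'.adicCompletion K)))
                        (((algebraMap (𝓞 K) K).mapMatrix (Matrix.diagonal ![1, 1, -1])).map (algebraMap K (w'.adicCompletion K)))ᵀ) x y).1 *
                    recordChar K (@vRat p hp) v w' ψ
                      (sesqForm (pairMatrix (((algebraMap (𝓞 K) K).mapMatrix (Matrix.diagonal ![1, 1, -1])).map (algebraMap K (w'.adicCompletion K)))
                        (((algebraMap (𝓞 K) K).mapMatrix (Matrix.diagonal ![1, 1, -1])).map (algebraMap K (w'.adicCompletion K)))ᵀ) x y).2 = 1) ↔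
                  ∀ i, Valued.v (x i).1 ≤ 1 ∧ Valued.v (x i).2 ≤ 1)) ∧
        (∃ (θ : maximalRealSubfield K) (y : K) (hθ : algebraMap (maximalRealSubfield K) K θ = y ^ 2)
          (hy : complexConj K y ≠ y) (r : ℕ) (l : Fin r → 𝓞 K)
          (_hl : Submodule.span (𝓞 (maximalRealSubfield K)) (Set.range l) = ⊤),
          letI := tensorStarRing K v
          letI := starRingOfQuadratic (finrank_eq_two K v w hθ hy (not_isSquare_of_staysPrime K v w hθ hy hmap))
            (localConj v w hθ.symm (span_pair_eq_top K hy) (not_isSquare_of_staysPrime K v w hθ hy hmap) (complexConj K))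
            (localConj_ne_one v w hθ.symm (span_pair_eq_top K hy) (not_isSquare_of_staysPrime K v w hθ hy hmap)
              (complexConj K) (complexConj_apply_eq_neg K hθ hy))
          haveI := isDiscreteValuationRing_integralClosure_adicCompletion v w
          haveI := finite_residueField_integralClosure_adicCompletion v w
          haveI : IsFractionRing (integralClosure (v.adicCompletionIntegers (maximalRealSubfield K)) (w.adicCompletion K))
            (w.adicCompletion K) :=
            integralClosure.isFractionRing_of_finite_extension (v.adicCompletion (maximalRealSubfield K))
              (w.adicCompletion K)
          ∃ (u₀ : (v.adicCompletionIntegers (maximalRealSubfield K))ˣ)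
            (Φ : ↥(formUnitaryGroup (J3 (algebraMap (v.adicCompletionIntegers (maximalRealSubfield K))
              (w.adicCompletion K) (u₀ : v.adicCompletionIntegers (maximalRealSubfield K))))) ≃*
              ↥(formUnitaryGroup (tensorGram K v (gramToy K))))
            (ϖ' : integralClosure (v.adicCompletionIntegers (maximalRealSubfield K)) (w.adicCompletion K))
            (hϖ' : Irreducible ϖ')
            (hs' : star (algebraMap (integralClosure (v.adicCompletionIntegers (maximalRealSubfield K))
              (w.adicCompletion K)) (w.adicCompletion K) ϖ') =
                algebraMap (integralClosure (v.adicCompletionIntegers (maximalRealSubfield K)) (w.adicCompletion K))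
                  (w.adicCompletion K) ϖ'),
            (∀ g, g ∈ hyperspecialSubgroup
                (integralClosure (v.adicCompletionIntegers (maximalRealSubfield K)) (w.adicCompletion K))
                (J3 (algebraMap (v.adicCompletionIntegers (maximalRealSubfield K)) (w.adicCompletion K)
                  (u₀ : v.adicCompletionIntegers (maximalRealSubfield K)))) ↔ Φ g ∈ recordHyperspecial K v l (gramToy K)) ∧
            ∀ {V : Type uV} [AddCommGroup V] [Module k V]
              (ρ : Representation k (↥(formUnitaryGroup (tensorGram K v (gramToy K)))) V) [ρ.IsIrreducible],
              KFinite ρ (recordHyperspecial K v l (gramToy K)) →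
              ∀ [FiniteDimensional k (invariants ρ (recordHyperspecial K v l (gramToy K)))],
              invariants ρ (recordHyperspecial K v l (gramToy K)) ≠ ⊥ →
              ∃ α : k, α ≠ 0 ∧ Nonempty (ρ.Equiv (comp Φ.symm
                (inertSphericalQuot
                  (hstar_of_star_eq (localConj v w hθ.symm (span_pair_eq_top K hy)
                    (not_isSquare_of_staysPrime K v w hθ hy hmap) (complexConj K))
                    (fun x => by rw [star_p8_eq_star K v w hθ hy (not_isSquare_of_staysPrime K v w hθ hy hmap)]; rfl))
                  (algebraMap (v.adicCompletionIntegers (maximalRealSubfield K)) (w.adicCompletion K)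
                    (u₀ : v.adicCompletionIntegers (maximalRealSubfield K)))
                  (star_algebraMap_of_star_eq (localConj v w hθ.symm (span_pair_eq_top K hy)
                    (not_isSquare_of_staysPrime K v w hθ hy hmap) (complexConj K))
                    (fun x => by rw [star_p8_eq_star K v w hθ hy (not_isSquare_of_staysPrime K v w hθ hy hmap)]; rfl)
                    (u₀ : v.adicCompletionIntegers (maximalRealSubfield K)))
                  (algebraMap_unit_ne_zero (F := v.adicCompletion (maximalRealSubfield K)) u₀)
                  (isInteger_algebraMap (u₀ : v.adicCompletionIntegers (maximalRealSubfield K)))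
                  (isInteger_algebraMap_unit_inv u₀) hϖ' hs' k (α * ((Ideal.absNorm v.asIdeal : k) ^ 2)⁻¹)))))}.Infinite := by
  letI := numberField' K
  letI := isCMField' K
  haveI : Infinite {p : ℕ // p.Prime ∧ orderOf (p : ZMod 7) = 6} :=
    infinite_setOf_prime_and_orderOf_eq_six.to_subtype
  refine Set.infinite_of_injective_forall_mem (vPrimeOf_injective K) fun p => ?_
  haveI hp : Fact p.1.Prime := ⟨p.2.1⟩
  have hmem : (p.1 : 𝓞 (maximalRealSubfield K)) ∈ (vPrimeOf K p).asIdeal := natCast_mem_vPrime K p.1 p.2.2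
  have hmap : Ideal.map (algebraMap (𝓞 (maximalRealSubfield K)) (𝓞 K)) (vPrimeOf K p).asIdeal =
      (wPrime K p.1 p.2.2).asIdeal := map_vPrime K p.1 p.2.2
  have h7 : (7 : 𝓞 (maximalRealSubfield K)) ∉ (vPrimeOf K p).asIdeal := seven_notMem_vPrime K p.1 p.2.2
  exact ⟨p.1, hp, p.2.2, hmem, wPrime K p.1 p.2.2, hmap,
    @joint_outside_discriminant_of_staysPrime K _ (numberField' K) (isCMField' K) (@vRat p.1 hp) (vPrimeOf K p)
      (@liesOver_vRat_of_mem p.1 hp _ _ _ (vPrimeOf K p) hmem)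
      (@discr_seven_notMem K _ (numberField' K) _ (vPrimeOf K p) h7)
      (wPrime K p.1 p.2.2) (@liesOver_of_map_eq K _ (numberField' K) (vPrimeOf K p) (wPrime K p.1 p.2.2) hmap) hmap
      k _ _ _⟩

end Seven

end Summit.Ventures.HodgeRepro2.T5RecordJointInfinitelyMany
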